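import Summits.Ventures.LatticeQCDFlow.Exactness.AcceptanceFromMeanEnergyViolationTwoState
import Summits.Ventures.LatticeQCDFlow.Exactness.AcceptanceFromMeanEnergyViolationPinsker
import Summits.RiemannHypothesis.RiemannHypothesis.Theorems.WeilCombCombShapePositivityLogConcaveCellRules
import HarnessLib

/-!
HONEST FRAMING: exact (Metropolis-corrected) sampling algorithms for lattice gauge theory; figures
of merit are autocorrelation/cost numbers at stated couplings and volumes; no continuum-physics
claim.

# AcceptanceFromMeanEnergyViolationTwoStateComparison — THE PENCIL CONTAINS PINSKER'S FLOOR (MEMBER `a = √(2m)`,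
# VIA `2(cosh a − 1) ≤ a·sinh a`), AND ROW 2'S PINSKER / BRETAGNOLLE–HUBER FLOORS EVALUATED AT THE TWO-STATE
# EXTREMISER: `1 − √(a tanh(a/2)/2) ≤ 2/(1+e^{a})` AND `1 − √(1 − e^{−a tanh(a/2)}) ≤ 2/(1+e^{a})` FOR EVERY `a > 0`
# (row 22 `su3-ptbc`, GEN-10, ours)

Venture `LatticeQCDFlow` (cell pub-lqcd), topic `Exactness`; FANOUT row 22 (`su3-ptbc`).  NEW WORK of the cell
assembled from this seat's `AcceptanceFromMeanEnergyViolationTwoState` (the two-state flip: `Z = 1 + e^{−a}`,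
`∫ ΔH e^{−H} = a(1 − e^{−a})`, `A = 2e^{−a}`) and row 2's `AcceptanceFromMeanEnergyViolation` (Bretagnolle–Huber:
`(1 − √(1 − e^{−⟨ΔH⟩}))·Z ≤ A`) / `AcceptanceFromMeanEnergyViolationPinsker` (`(1 − √(⟨ΔH⟩/2))·Z ≤ A`), and the
tree's hyperbolic inequality `0 ≤ 2 − 2cosh y + y sinh y` (`WeilCombBohrFejer.two_sub_two_mul_cosh_add_mul_sinh_nonneg`,
RH summit, reused not restated).  Nothing is cited as a fact; no numerics.

THE POINT.  (1) The pencil `1 − A/Z ≤ (cosh a − 1 + m)/(a + sinh a)` of `AcceptanceFromMeanEnergyViolationSharp`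
reproduces Pinsker's floor at its member `a = √(2m)`: `(cosh a − 1 + a²/2)/(a + sinh a) ≤ a/2`, which is the
hyperbolic inequality `2(cosh a − 1) ≤ a sinh a` (`⇔ tanh(a/2) ≤ a/2`; in the tree as
`WeilCombBohrFejer.two_sub_two_mul_cosh_add_mul_sinh_nonneg`).  So the pencil's envelope is at least as good as
Pinsker at every `m`, with no appeal to row 13's density Pinsker.  (2) Conversely, row 2's two floors hold for
the two-state flip, whose numbers are known in closed form; instantiating them there turns two measure-theoretic
theorems of the tree into two transcendental inequalities, `1 − √(a tanh(a/2)/2) ≤ 2/(1 + e^{a})` and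
`1 − √(1 − e^{−a tanh(a/2)}) ≤ 2/(1 + e^{a})` (`a > 0`), i.e. row 2's floors lie BELOW the extremal rate everywhere —
a consistency check of the whole packet (floor ≤ attained value), typed rather than plotted.

## What is proved

* §1 **`coshPencil_sqrt_le_pinsker`** (`m > 0`, `a = √(2m)`: `(cosh a − 1 + m)/(a + sinh a) ≤ √(m/2)`).
* §2 **`pinskerFloor_le_twoState_rate`** and **`bhFloor_le_twoState_rate`** (`a > 0`), with
  `m₂(a) = a(1 − e^{−a})/(1 + e^{−a})`:  `1 − √(m₂(a)/2) ≤ 2e^{−a}/(1 + e^{−a})` and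
  `1 − √(1 − e^{−m₂(a)}) ≤ 2e^{−a}/(1 + e^{−a})`.

Literature grade (cell rule): elementary inequalities; NEW TYPING.  NOT CLAIMED: anything about a run.
-/

namespace Summit.Ventures.LatticeQCDFlow.Exactness

open Real MeasureTheory Set
open Summit.RiemannHypothesis.RiemannHypothesis.Theorems.WeilCombBohrFejer
  (two_sub_two_mul_cosh_add_mul_sinh_nonneg)

/-! ## §1 The Pinsker member of the pencil -/

section PinskerMember

/-- **THE PENCIL CONTAINS PINSKER'S FLOOR**: for `m > 0` and `a = √(2m)`,
`(cosh a − 1 + m)/(a + sinh a) ≤ √(m/2)` — so `involutive_acceptance_ge_cosh` at `a = √(2m)` is at least as strong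
as `involutive_acceptance_ge_pinsker`. [ours] -/
theorem coshPencil_sqrt_le_pinsker {m : ℝ} (hm : 0 < m) :
    (Real.cosh (Real.sqrt (2 * m)) - 1 + m) / (Real.sqrt (2 * m) + Real.sinh (Real.sqrt (2 * m)))
      ≤ Real.sqrt (m / 2) := by
  set a := Real.sqrt (2 * m) with ha_def
  have ha : 0 < a := Real.sqrt_pos.mpr (by linarith)
  have hsq : a ^ 2 = 2 * m := by rw [ha_def, Real.sq_sqrt (by linarith)]
  have hm_eq : m = a ^ 2 / 2 := by linarith
  have hsqrt : Real.sqrt (m / 2) = a / 2 := by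
    rw [show m / 2 = (a / 2) ^ 2 by rw [hm_eq]; ring, Real.sqrt_sq (by linarith)]
  have hc : 0 < a + Real.sinh a := add_pos ha (Real.sinh_pos_iff.mpr ha)
  rw [hsqrt, div_le_iff₀ hc, hm_eq]
  nlinarith [two_sub_two_mul_cosh_add_mul_sinh_nonneg ha.le]

end PinskerMember

/-! ## §2 Row 2's floors at the two-state extremiser -/

section AtTwoState

/-- **PINSKER'S FLOOR AT THE TWO-STATE FLIP**: for `a > 0`, with `m₂ = a(1 − e^{−a})/(1 + e^{−a})` (`= a tanh(a/2)`,
the flip's mean violation) — `1 − √(m₂/2) ≤ 2e^{−a}/(1 + e^{−a})` (its acceptance `= 1 − tanh(a/2)`). [ours] -/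
theorem pinskerFloor_le_twoState_rate {a : ℝ} (ha : 0 < a) :
    1 - Real.sqrt (a * (1 - Real.exp (-a)) / (1 + Real.exp (-a)) / 2)
      ≤ 2 * Real.exp (-a) / (1 + Real.exp (-a)) := by
  have hv : 0 < Real.exp (-a) := Real.exp_pos _
  have hZpos : 0 < 1 + Real.exp (-a) := by linarith
  have h := involutive_acceptance_ge_pinsker (μ := Measure.dirac false + Measure.dirac true)
    (H := fun b : Bool => if b then a else 0) (Ψ := not) (measurable_of_countable _) (measurable_of_countable _)
    bool_not_involutive measurePreserving_not_twoPoint Integrable.of_finite Integrable.of_finite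
    (by rw [twoState_partition]; exact hZpos)
  rw [twoState_partition, twoState_meanViolation, twoState_acceptance ha.le] at h
  rw [le_div_iff₀ hZpos]
  exact h

/-- **THE BRETAGNOLLE–HUBER FLOOR AT THE TWO-STATE FLIP**: for `a > 0`,
`1 − √(1 − e^{−m₂}) ≤ 2e^{−a}/(1 + e^{−a})`, `m₂ = a(1 − e^{−a})/(1 + e^{−a})`. [ours] -/
theorem bhFloor_le_twoState_rate {a : ℝ} (ha : 0 < a) :
    1 - Real.sqrt (1 - Real.exp (-(a * (1 - Real.exp (-a)) / (1 + Real.exp (-a)))))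
      ≤ 2 * Real.exp (-a) / (1 + Real.exp (-a)) := by
  have hv : 0 < Real.exp (-a) := Real.exp_pos _
  have hZpos : 0 < 1 + Real.exp (-a) := by linarith
  have h := involutive_acceptance_ge (μ := Measure.dirac false + Measure.dirac true)
    (H := fun b : Bool => if b then a else 0) (Ψ := not) (measurable_of_countable _) (measurable_of_countable _)
    bool_not_involutive measurePreserving_not_twoPoint Integrable.of_finite Integrable.of_finite
    (by rw [twoState_partition]; exact hZpos)
  rw [twoState_partition, twoState_meanViolation, twoState_acceptance ha.le] at h
  rw [le_div_iff₀ hZpos]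
  exact h

end AtTwoState

end Summit.Ventures.LatticeQCDFlow.Exactness
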